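import Mathlib.Topology.Homotopy.Equiv
import Literature.Topology.FourManifolds.RLinkSphere
import HarnessLib

/-!
# The closed `4`-manifold of an R-link is a homotopy `4`-sphere

Topic `Literature/Topology/FourManifolds`; companion of `RLinkSphere.lean` (definition item
`defn-IsRLinkSphere` of the route `SmoothPoincare4/VerlindeRLinks`: `FramedLink.IsTrace L P`, the
compact trace `B⁴ ∪_L (2-handles)`, and `IsRLinkSphere X L`, the closed manifold
`Σ_L = trace ∪_φ ♮ⁿ S¹ × B³`, i.e. `0h ∪ (2-handles along L) ∪ n·(3h) ∪ 4h`).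

Gompf–Scharlemann–Thompson, Geom. Topol. 14 (2010), §9 (p. 19 of arXiv:1103.1601): *"Suppose `L`
is an `n`-component link on which surgery gives `#_n(S¹ × S²)`. … Consider the closed `4`-manifold
`W` obtained by attaching `2`-handles to `D⁴` via the framed link `L`, then attaching
`♮_n(S¹ × B³)` to the resulting manifold along their common boundary `#_n(S¹ × S²)`.  Via [LP] we
know there is essentially only one way to do this.  The result is a simply-connected (since no
`1`-handles are attached) homology `4`-sphere, hence a homotopy `4`-sphere"*; proof of Prop. 9.2:
*"a smooth homotopy `4`-sphere `Σ` can be constructed by attaching to the trace of the surgery `n`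
`3`-handles and a `4`-handle"*.

* `IsRLinkSphere.nonempty_homotopyEquiv_sphere` — this statement as a **named fact** (D-0014):
  every Hausdorff, second countable smooth `X` with `IsRLinkSphere X L` is homotopy equivalent to
  `S⁴` (Mathlib's `ContinuousMap.HomotopyEquiv`, the form consumed by `Knot.IsHomotopyBallSlice`,
  `HomotopyBallSlice.lean`, and by the homotopy-sphere clauses of the SPC4 statements).  It holds
  for every such `X`: a gluing `X = P ∪_φ V` forces `∂P ≅ ∂V ≅ #ⁿ S¹ × S²`, so `L` is an R-link
  and `X` is GST's `W` (any `φ`, by Laudenbach–Poénaru).  A proof in the tree would run through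
  van Kampen for the gluing (`π₁ = 1`: no `1`-handles), the Euler characteristic / Mayer–Vietoris
  count `H₂ = 0`, and the recognition lemma `nonempty_homotopyEquiv_sphere_four_iff`
  (`SPC4Wave0.lean`).
* `exists_homotopySphere_of_isRLinkSphere_of_isEmpty_diffeomorph` (**proved** from the fact) —
  the use made of it on the negative side of SPC4 (Gompf–Scharlemann–Thompson, Prop. 9.2: SPC4
  for *"homotopy spheres that admit handle decompositions without 1-handles"*): an R-link sphere
  that is not diffeomorphic to `S⁴` is an exotic `4`-sphere, packaged as in
  `Knot.exists_exotic_of_isHomotopyBallSlice_not_isSmoothlySlice` (`HomotopyBallSlice.lean`).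

Not asserted here (roadmap of `RLinkSphere.lean`, to be *proved* from tree material): existence of
the trace (`HandleAttachingMap.exists_isMultiAttachment` with attaching maps from framed tubes,
`TubeAttachData.attachingMap`), `∂(trace) = S³_L` (Kosinski's identification restricted to `∂D⁴`
is `Link.surgeryRel`), existence and uniqueness of `Σ_L` for an R-link (`exists_isBoundaryGluing`,
UNIQ₄, Laudenbach–Poénaru `exists_diffeomorph_comp_incl_eq`), and the cores of the `2`-handles as
proper discs for the components off the `0`-handle (Gompf–Scharlemann–Thompson, Prop. 2.3).

## References

* R. E. Gompf, M. Scharlemann, A. Thompson, Geom. Topol. 14 (2010) 2305–2347 (arXiv:1103.1601),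
  §9 and Prop. 9.2 with its proof. [GompfScharlemannThompson2010]
* R. C. Kirby, *The Topology of 4-Manifolds*, LNM 1374 (1989), Ch. I §2, p. 8. [Kirby1989]
* F. Laudenbach, V. Poénaru, *A note on 4-dimensional handlebodies*, Bull. SMF 100 (1972)
  337–344. [LaudenbachPoenaruBSMF1972]
-/

open scoped Manifold ContDiff Topology ContinuousMap
open Set Function Metric

noncomputable section

namespace Literature.Topology.FourManifolds

/-- Local notation: `𝔼 n` is the model Euclidean space `EuclideanSpace ℝ (Fin n)`. -/
local notation "𝔼 " n:arg => EuclideanSpace ℝ (Fin n)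

/-- Local notation: `𝕊 n` is the unit sphere in `EuclideanSpace ℝ (Fin (n + 1))`. -/
local notation "𝕊 " n:arg => (Metric.sphere (0 : EuclideanSpace ℝ (Fin (n + 1))) 1)

/-! ### The named fact -/

/-- **An R-link sphere is a homotopy `4`-sphere.**  Gompf–Scharlemann–Thompson (2010), §9:
*"Consider the closed `4`-manifold `W` obtained by attaching `2`-handles to `D⁴` via the framed
link `L`, then attaching `♮_n(S¹ × B³)` to the resulting manifold along their common boundary
`#_n(S¹ × S²)`.  Via [LP] we know there is essentially only one way to do this.  The result is a
simply-connected (since no `1`-handles are attached) homology `4`-sphere, hence a homotopy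
`4`-sphere"*; proof of Prop. 9.2: *"a smooth homotopy `4`-sphere `Σ` can be constructed by
attaching to the trace of the surgery `n` `3`-handles and a `4`-handle"* (no `1`-handles, so
`π₁ = 1`; Euler characteristic `1 + n - n + 1 = 2` and `H₁ = H₃ = 0`, so `H₂ = 0`).  Tree
rendering, at universe `0` (the universe of the consumers `Knot.IsHomotopyBallSlice` and the
SPC4 statements): a Hausdorff, second countable smooth `X` with `IsRLinkSphere X L`
(`RLinkSphere.lean`: `X = P ∪_φ V`, `P` a trace of `L`, `V` a compact connected orientable
`(1,n)`-handlebody — which forces `∂P ≅ #ⁿ S¹ × S²`, so that `X` is the `W` of the source, for any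
`φ` by Laudenbach–Poénaru) is homotopy equivalent to `S⁴` (Mathlib's `ContinuousMap.HomotopyEquiv`).
[cite: GompfScharlemannThompson2010, §9 and proof of Prop. 9.2] -/
def IsRLinkSphere.nonempty_homotopyEquiv_sphere : Prop :=
  ∀ (n : ℕ) (L : FramedLink (Fin n)) (X : Type) [TopologicalSpace X] [T2Space X]
    [SecondCountableTopology X] [ChartedSpace (𝔼 4) X] [IsManifold (𝓡 4) ∞ X],
    IsRLinkSphere X L → Nonempty (X ≃ₕ (𝕊 4))

/-! ### Its use on the negative side of SPC4 (proved from the fact) -/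

/-- **An R-link sphere which is not diffeomorphic to `S⁴` is an exotic `4`-sphere** (GRANTED the
named fact `IsRLinkSphere.nonempty_homotopyEquiv_sphere`): it is compact
(`IsRLinkSphere.compactSpace`), homotopy equivalent to `S⁴` by the fact, and not diffeomorphic to
it by hypothesis — packaged as the conclusion of
`Knot.exists_exotic_of_isHomotopyBallSlice_not_isSmoothlySlice` (`HomotopyBallSlice.lean`), i.e. as
a counterexample to the smooth `4`-dimensional Poincaré conjecture *"for homotopy spheres that
admit handle decompositions without 1-handles"* (Gompf–Scharlemann–Thompson (2010), Prop. 9.2 and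
its proof: *"Hence `Σ` is diffeomorphic to `S⁴` as required"* is what fails here).
[cite: GompfScharlemannThompson2010, Prop. 9.2 and its proof] -/
theorem exists_homotopySphere_of_isRLinkSphere_of_isEmpty_diffeomorph
    (hH : IsRLinkSphere.nonempty_homotopyEquiv_sphere) {n : ℕ} (L : FramedLink (Fin n))
    (X : Type) [TopologicalSpace X] [T2Space X] [SecondCountableTopology X]
    [ChartedSpace (𝔼 4) X] [IsManifold (𝓡 4) ∞ X] (hX : IsRLinkSphere X L)
    (hne : IsEmpty (X ≃ₘ⟮𝓡 4, 𝓡 4⟯ (𝕊 4))) :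
    ∃ (M : Type) (_ : TopologicalSpace M) (_ : T2Space M) (_ : SecondCountableTopology M)
      (_ : ChartedSpace (𝔼 4) M) (_ : IsManifold (𝓡 4) ∞ M) (_ : CompactSpace M),
      Nonempty (M ≃ₕ 𝕊 4) ∧ IsEmpty (M ≃ₘ⟮𝓡 4, 𝓡 4⟯ 𝕊 4) := by
  haveI : CompactSpace X := hX.compactSpace
  exact ⟨X, ‹_›, ‹_›, ‹_›, ‹_›, ‹_›, ‹_›, hH n L X hX, hne⟩

end Literature.Topology.FourManifolds

end
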